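import Mathlib
import Summits.Schanuel.Schanuel.Statement
import Literature.NumberTheory.Transcendental.RoyCriterion
import Literature.NumberTheory.Transcendental.RoyCriterionProofs
import Literature.NumberTheory.Transcendental.RoyCriterionThm3Proofs
import Summits.Schanuel.Schanuel.Theorems.SoloBlindJetBoxPrinciple
import Summits.Schanuel.Schanuel.Theorems.SoloBlindSubDirichletCount
import HarnessLib

/-!
# Roy's hypothesis is void below the Dirichlet exponent — which part of Conjecture 2 is load-bearing

`Summits/Schanuel/Schanuel/Theorems/SoloBlindSubDirichlet.lean` (soloist `solo-Schanuel-blind`,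
session 12).

Roy (Acta Arith. 97 (2001)) proved that Schanuel's conjecture in rank `l` is equivalent to his
Conjecture 2 (`RoyCriterion l ↔ SchanuelRank l`, `Roy2001_iff`): for exponents in the window
(1) `max(1, t₀, 2t₁) < min(s₀, 2s₁)`, `max(s₀, s₁ + t₁) < u < (1 + t₀ + t₁)/2` (`RoyAdmissible`),
a sequence `0 ≠ P_N ∈ ℤ[X₀, X₁]` of partial degrees `≤ N^{t₀}, N^{t₁}` and height `≤ e^N` whose
`D`-jets (`D = ∂₀ + X₁∂₁`) of depth `N^{s₀}` are `≤ e^{−N^u}` on the translation box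
`{(Σ mⱼyⱼ, Π αⱼ^{mⱼ}) : mⱼ ≤ N^{s₁}}` (`RoyHypothesis y α s₀ s₁ t₀ t₁ u`) should force
`trdeg_ℚ ℚ(y, α) ≥ l` when `y` is `ℚ`-linearly independent.

This file determines, in the kernel, WHERE in this hypothesis the information sits.  The hypothesis
is a system of `≍ N^{s₀} · N^{l s₁}` conditions of strength `e^{−N^u}` on the `≍ N^{t₀+t₁}`
integer coefficients of `P_N`, each with `≍ N` free digits.  We prove that as soon as the count is
sub-Dirichlet,
`s₀ + l·s₁ + u < 1 + t₀ + t₁`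
(with Roy's side conditions in the weak form `s₀, s₁, t₁ ≥ 0`, `u ≥ 1`, `max(s₀, t₀, s₁+t₁) ≤ u`),
the hypothesis holds at EVERY pair of tuples `y, α ∈ ℂ^l` (`royHypothesis_of_subDirichlet`) — so it
implies nothing.  Ingredients, all proved here: the derivation `D` is the vector field of the
one-parameter group `w ↦ (ξ + w, η e^w)` through every point of `ℂ²` (`iteratedDeriv_shiftEval`),
whence a Cauchy bound for the jet coefficients `(D^k X₀^aX₁^b)(ξ, η)`
(`norm_jetAt_monoXY_le`); Dirichlet's box principle for the real and imaginary parts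
of the jets at an arbitrary finite set of points (`exists_polyOfCoeffs_jets_le`, from the tree's
`exists_ne_zero_int_forms_le`); and the exponent bookkeeping (`eventually_subDirichlet_count`).

Consequences on Roy's window (`RoyAdmissible`):
* `royHypothesis_translationFree`: with translation exponent `0` the hypothesis holds for every
  `l`, `y`, `α` — the `D`-tower of depth `N^{s₀}` at the `2^l` subset sums carries no information
  (`s₀ + u < 2u < 1 + t₀ + t₁`); `royHypothesis_point`: in particular at any single point
  `(ξ, η) ∈ ℂ²`; `not_royCriterion_translationFree`: the translation-free criterion is false in
  rank one (witness `(1, 1)`).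
* `royHypothesis_derivativeFree_rankOne`: in rank one the translations alone (derivation exponent
  `0`) are void as well (`s₁ + u < 2u − t₁ < 1 + t₀`).
* `dirichletExcess_pos_of_royAdmissible`: the genuine hypothesis always has positive excess,
  `1 + t₀ + t₁ < s₀ + s₁ + u` (consistency with Roy's Theorem 1, which refutes the hypothesis at
  `l = 1`, `α ∉ e^y·μ_∞`); `dirichletExcess_nonneg_of_criterion`: conversely ANY valid implication
  "`RoyHypothesis` ⟹ `Q(y, α)`" with a non-trivial conclusion needs excess `≥ 0`.

Reading for the summit.  A proof of Roy's criterion — equivalently (Roy) of Schanuel's conjecture —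
must be an argument that breaks down below the Dirichlet exponent: it has to consume the excess
`s₀ + l s₁ + u − (1 + t₀ + t₁) > 0`, and on the window this excess exists only as the PRODUCT of the
depth of the `D`-tower and the volume of the `l`-dimensional translation box; in rank one neither
factor alone carries information, and Roy's Theorem 1 (the one proved case) indeed couples them.
Profile-reading criteria (cardinality/degree/height/size of a family of small polynomials) were
refuted on the window in `SoloBlindProfileCriteriaRefuted.lean`; the present file shows that also
the `D`-structure at boundedly many points is empty, locating the content of Conjecture 2 in the
arithmetic of the orbit `{(D^k P_N)(m·y, α^m)}` over `≫ N^{1 + t₀ + t₁ − u − s₀}` translates.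

References: D. Roy, *An arithmetic criterion for the values of the exponential function*, Acta
Arith. 97 (2001) 183–194 (Conjectures 1–2, condition (1), Theorems 1–3); M. Waldschmidt,
*Transcendance et exponentielles en plusieurs variables*, Invent. Math. 63 (1981), §3 (Lemme 3.3,
the box principle); M. Waldschmidt, *Diophantine approximation on linear algebraic groups*,
Grundlehren 326 (2000), §15.4.
-/

noncomputable section

open Filter Complex MvPolynomial Metric

namespace Summit.Schanuel.Schanuel.Theorems

open Literature.NumberTheory.Transcendental

/-! ### Roy's hypothesis below the Dirichlet exponent -/

/-- **Roy's hypothesis is void below the Dirichlet exponent.** Let `s₀, s₁, t₁ ≥ 0` and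
`u ≥ 1` satisfy Roy's side conditions in weak form `max(s₀, t₀, s₁ + t₁) ≤ u`, and the
sub-Dirichlet inequality `s₀ + l·s₁ + u < 1 + t₀ + t₁` (number of conditions
`≍ N^{s₀} · N^{l s₁}`, each of strength `e^{−N^u}`, against `≍ N^{t₀+t₁} · N` free digits of the
coefficients).  Then the hypothesis of Roy's Conjecture 2 with these exponents holds at EVERY pair
of tuples `y, α ∈ ℂ^l` — linearly dependent or not, related to the exponential map or not: for
all large `N` there is `0 ≠ P_N ∈ ℤ[X₀,X₁]`, `deg ≤ (N^{t₀}, N^{t₁})`, `H(P_N) ≤ e^N`, with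
`|(D^k P_N)(Σ m_j y_j, Π α_j^{m_j})| ≤ e^{−N^u}` for all `k ≤ N^{s₀}`, `m_j ≤ N^{s₁}`.
(Box principle for the `2(⌊N^{s₀}⌋+1)(⌊N^{s₁}⌋+1)^l` real jet forms, `exists_polyOfCoeffs_jets_le`,
with the count `eventually_subDirichlet_count`; the Cauchy bound for the jet coefficients uses that
`D` is the vector field of `w ↦ (ξ + w, η e^w)` through every point.)  Consequently no statement
of the form "`RoyHypothesis y α s₀ s₁ t₀ t₁ u` ⟹ (anything about `y, α`)" can be valid in this
range: whatever a proof of Roy's criterion uses, it must consume the Dirichlet excess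
`s₀ + l s₁ + u − (1 + t₀ + t₁) > 0`, which on Roy's window is supplied only jointly by the depth
`N^{s₀}` of the `D`-tower AND the growth `N^{l s₁}` of the translation box
(`dirichletExcess_pos_of_royAdmissible`, `royHypothesis_translationFree`). [this work] -/
theorem royHypothesis_of_subDirichlet {l : ℕ} (y α : Fin l → ℂ) {s₀ s₁ t₀ t₁ u : ℝ}
    (hs₀ : 0 ≤ s₀) (hs₁ : 0 ≤ s₁) (ht₁ : 0 ≤ t₁) (hu : 1 ≤ u) (hs₀u : s₀ ≤ u) (ht₀u : t₀ ≤ u)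
    (hst : s₁ + t₁ ≤ u) (hdir : s₀ + l * s₁ + u < 1 + t₀ + t₁) :
    RoyHypothesis y α s₀ s₁ t₀ t₁ u := by
  classical
  set c : ℝ := ∑ j, ‖y j‖ with hc_def
  have hc : 0 ≤ c := Finset.sum_nonneg fun j _ => norm_nonneg _
  set a : ℝ := ∏ j, max 1 ‖α j‖ with ha_def
  have ha : 1 ≤ a := Finset.prod_induction _ (fun x : ℝ => 1 ≤ x)
    (fun _ _ hx hy => one_le_mul_of_one_le_of_one_le hx hy) le_rfl (fun j _ => le_max_left _ _)
  have he1 : (1 : ℝ) ≤ Real.exp 1 := by have := Real.add_one_le_exp (1 : ℝ); linarith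
  filter_upwards [eventually_subDirichlet_count hs₀ hs₁ ht₁ hu hs₀u ht₀u hst hdir hc ha]
    with N hN
  have hN0 : (0 : ℝ) ≤ N := Nat.cast_nonneg N
  -- the parameters
  set T₀ : ℕ := ⌊(N : ℝ) ^ t₀⌋₊ with hT₀_def
  set T₁ : ℕ := ⌊(N : ℝ) ^ t₁⌋₊ with hT₁_def
  set K : ℕ := ⌊(N : ℝ) ^ s₀⌋₊ with hK_def
  set M : ℕ := ⌊(N : ℝ) ^ s₁⌋₊ with hM_def
  set X : ℕ := ⌊Real.exp N⌋₊ with hX_def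
  have hT₀ : (T₀ : ℝ) ≤ (N : ℝ) ^ t₀ := Nat.floor_le (Real.rpow_nonneg hN0 _)
  have hT₀' : (N : ℝ) ^ t₀ < T₀ + 1 := Nat.lt_floor_add_one _
  have hT₁ : (T₁ : ℝ) ≤ (N : ℝ) ^ t₁ := Nat.floor_le (Real.rpow_nonneg hN0 _)
  have hT₁' : (N : ℝ) ^ t₁ < T₁ + 1 := Nat.lt_floor_add_one _
  have hK : (K : ℝ) ≤ (N : ℝ) ^ s₀ := Nat.floor_le (Real.rpow_nonneg hN0 _)
  have hM : (M : ℝ) ≤ (N : ℝ) ^ s₁ := Nat.floor_le (Real.rpow_nonneg hN0 _)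
  have hXle : (X : ℝ) ≤ Real.exp N := Nat.floor_le (Real.exp_pos _).le
  have hX : Real.exp N < X + 1 := Nat.lt_floor_add_one _
  set A : ℝ := K.factorial * ((((T₀ + 1) * (T₁ + 1) : ℕ) : ℝ) *
    (((M : ℝ) * c + 1) ^ T₀ * (a ^ M * Real.exp 1) ^ T₁)) with hA_def
  have hR₁1 : 1 ≤ a ^ M * Real.exp 1 := one_le_mul_of_one_le_of_one_le (one_le_pow₀ ha) he1
  have hA1 : 1 ≤ A := by
    have h1 : (1 : ℝ) ≤ K.factorial := by exact_mod_cast Nat.succ_le_of_lt (Nat.factorial_pos K)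
    have h2 : (1 : ℝ) ≤ (((T₀ + 1) * (T₁ + 1) : ℕ) : ℝ) := by
      exact_mod_cast Nat.succ_le_of_lt (by positivity)
    have h3 : (1 : ℝ) ≤ ((M : ℝ) * c + 1) ^ T₀ :=
      one_le_pow₀ (by nlinarith [mul_nonneg (Nat.cast_nonneg M) hc])
    have h4 : (1 : ℝ) ≤ (a ^ M * Real.exp 1) ^ T₁ := one_le_pow₀ hR₁1
    exact one_le_mul_of_one_le_of_one_le h1
      (one_le_mul_of_one_le_of_one_le h2 (one_le_mul_of_one_le_of_one_le h3 h4))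
  have hA0 : 0 ≤ A := zero_le_one.trans hA1
  set ℓ : ℕ := ⌊2 * (X : ℝ) * A * Real.exp ((N : ℝ) ^ u)⌋₊ + 1 with hℓ_def
  have hℓpos : 0 < ℓ := Nat.succ_pos _
  have hℓgt : 2 * (X : ℝ) * A * Real.exp ((N : ℝ) ^ u) < ℓ := by
    rw [hℓ_def]; push_cast; exact Nat.lt_floor_add_one _
  have hℓle : (ℓ : ℝ) ≤ 3 * Real.exp N * A * Real.exp ((N : ℝ) ^ u) := by
    have h1 : (ℓ : ℝ) ≤ 2 * (X : ℝ) * A * Real.exp ((N : ℝ) ^ u) + 1 := by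
      rw [hℓ_def]; push_cast
      linarith [Nat.floor_le (show 0 ≤ 2 * (X : ℝ) * A * Real.exp ((N : ℝ) ^ u) by positivity)]
    have h2 : (1 : ℝ) ≤ Real.exp N * A * Real.exp ((N : ℝ) ^ u) :=
      one_le_mul_of_one_le_of_one_le (one_le_mul_of_one_le_of_one_le (Real.one_le_exp hN0) hA1)
        (Real.one_le_exp (Real.rpow_nonneg hN0 _))
    have h3 : 2 * (X : ℝ) * A * Real.exp ((N : ℝ) ^ u) ≤
        2 * Real.exp N * A * Real.exp ((N : ℝ) ^ u) := by gcongr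
    linarith
  have hcnt := hN T₀ T₁ K M X ℓ hT₀ hT₀' hT₁ hT₁' hK hM hX hℓpos hℓle
  -- the points of the translation box
  set ξ : (Fin l → Fin (M + 1)) → ℂ := fun i => ∑ j, ((i j : ℕ) : ℂ) * y j with hξ_def
  set η : (Fin l → Fin (M + 1)) → ℂ := fun i => ∏ j, α j ^ (i j : ℕ) with hη_def
  have hR : ∀ i, ‖ξ i‖ ≤ M * c := fun i => norm_sum_natMul_le y i
  have hR₁ : ∀ i, ‖η i‖ * Real.exp 1 ≤ a ^ M * Real.exp 1 := fun i =>
    mul_le_mul_of_nonneg_right (norm_prod_pow_le α i) (Real.exp_pos 1).le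
  have hcard : Fintype.card (Fin l → Fin (M + 1)) = (M + 1) ^ l := by simp
  obtain ⟨t, ht0, htX, hjets⟩ := exists_polyOfCoeffs_jets_le ξ η T₀ T₁ K X ℓ hR hR₁ hR₁1 hℓpos
    (by rw [hcard]; exact hcnt)
  refine ⟨polyOfCoeffs t, polyOfCoeffs_ne_zero ht0, ?_, ?_, ?_, ?_⟩
  · calc ((polyOfCoeffs t).degreeOf 0 : ℝ) ≤ T₀ := by exact_mod_cast degreeOf_polyOfCoeffs_fst t
      _ ≤ (N : ℝ) ^ t₀ := hT₀
  · calc ((polyOfCoeffs t).degreeOf 1 : ℝ) ≤ T₁ := by exact_mod_cast degreeOf_polyOfCoeffs_snd t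
      _ ≤ (N : ℝ) ^ t₁ := hT₁
  · have htX' : ∀ i, |(t i : ℝ)| ≤ X := fun i => by
      rw [← Int.cast_abs]; exact_mod_cast htX i
    have htnorm : ‖t‖ ≤ X := by
      refine (pi_norm_le_iff_of_nonneg (by positivity)).2 fun i => ?_
      rw [Int.norm_eq_abs]
      exact htX' i
    exact (mvPolyHeight_polyOfCoeffs_le t).trans (htnorm.trans hXle)
  · intro k m hk hm
    have hkK : k ≤ K := Nat.le_floor hk
    have hmM : ∀ j, m j < M + 1 := fun j => Nat.lt_succ_of_le (Nat.le_floor (hm j))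
    set i : Fin l → Fin (M + 1) := fun j => ⟨m j, hmM j⟩ with hi_def
    have hpt : (![∑ j, (m j : ℂ) * y j, ∏ j, α j ^ m j] : Fin 2 → ℂ) = ![ξ i, η i] := rfl
    rw [hpt]
    have hℓr : (0 : ℝ) < ℓ := by exact_mod_cast hℓpos
    calc ‖aeval ![ξ i, η i] (royD^[k] (polyOfCoeffs t))‖ ≤ 2 * (X * A / ℓ) := hjets k hkK i
      _ = 2 * X * A / ℓ := by ring
      _ ≤ Real.exp (-(N : ℝ) ^ u) := by
          rw [div_le_iff₀ hℓr]
          calc 2 * (X : ℝ) * A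
              = 2 * X * A * Real.exp ((N : ℝ) ^ u) * Real.exp (-(N : ℝ) ^ u) := by
                rw [mul_assoc (2 * X * A), ← Real.exp_add, add_neg_cancel, Real.exp_zero, mul_one]
            _ ≤ ℓ * Real.exp (-(N : ℝ) ^ u) :=
                mul_le_mul_of_nonneg_right hℓgt.le (Real.exp_pos _).le
            _ = Real.exp (-(N : ℝ) ^ u) * ℓ := mul_comm _ _

/-! ### Consequences on Roy's window -/

/-- **The derivation tower alone carries no information on Roy's window.** For every admissible
`(s₀, s₁, t₀, t₁, u)` (Roy 2001, condition (1)), every `l` and EVERY `y, α ∈ ℂ^l`, Roy's hypothesis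
with translation exponent `0` — `D`-jets of depth `N^{s₀}` at the `2^l` subset sums
`(Σ_{j∈S} y_j, Π_{j∈S} α_j)` — holds: `s₀ + u < 2u < 1 + t₀ + t₁`.  In particular no criterion
of Roy's shape reading the `D`-tower at one point (or at boundedly many points) can be valid
anywhere in the window, whatever its conclusion. [this work] -/
theorem royHypothesis_translationFree {s₀ s₁ t₀ t₁ u : ℝ} (hadm : RoyAdmissible s₀ s₁ t₀ t₁ u)
    {l : ℕ} (y α : Fin l → ℂ) : RoyHypothesis y α s₀ 0 t₀ t₁ u := by
  obtain ⟨hs₀, hs₁, ht₀, ht₁, hu, h1, h2, h3⟩ := hadm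
  have hmax := max_lt_iff.1 h1
  have hmax' := max_lt_iff.1 hmax.2
  have h1s₀ : 1 < s₀ := lt_of_lt_of_le hmax.1 (min_le_left _ _)
  have ht₀s₀ : t₀ < s₀ := lt_of_lt_of_le hmax'.1 (min_le_left _ _)
  have hs₀u : s₀ < u := lt_of_le_of_lt (le_max_left _ _) h2
  have hst : s₁ + t₁ < u := lt_of_le_of_lt (le_max_right _ _) h2
  refine royHypothesis_of_subDirichlet y α hs₀.le le_rfl ht₁.le (by linarith) hs₀u.le
    (by linarith) (by linarith) ?_
  simp only [mul_zero, add_zero]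
  linarith

/-- **No single-point form of Roy's criterion.** For admissible exponents and ANY `(ξ, η) ∈ ℂ²`
the `D`-jet data of Conjecture 2 at the point `(ξ, η)` (and at `(0, 1)`) exist:
`RoyHypothesis ![ξ] ![η] s₀ 0 t₀ t₁ u`.  (Kernel form of the prose no-go "F7/C23" of the wall:
the information of Roy's hypothesis is not located at any point.) [this work] -/
theorem royHypothesis_point {s₀ s₁ t₀ t₁ u : ℝ} (hadm : RoyAdmissible s₀ s₁ t₀ t₁ u) (ξ η : ℂ) :
    RoyHypothesis ![ξ] ![η] s₀ 0 t₀ t₁ u :=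
  royHypothesis_translationFree hadm _ _

/-- **Consistency with Roy's Theorem 1 / Conjecture 2**: admissible exponents always have
POSITIVE Dirichlet excess already for one translation direction, `1 + t₀ + t₁ < s₀ + s₁ + u`
(`t₀ < s₀`, `t₁ < s₁`, `1 < u`); so `royHypothesis_of_subDirichlet` never applies to the genuine
hypothesis of Conjecture 2 with `l ≥ 1`, as it must not (Roy's Theorem 1 refutes the hypothesis at
`l = 1`, `α ∉ e^y·μ_∞`). The content of Conjecture 2 lives exactly in this excess. [this work] -/
theorem dirichletExcess_pos_of_royAdmissible {s₀ s₁ t₀ t₁ u : ℝ}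
    (hadm : RoyAdmissible s₀ s₁ t₀ t₁ u) : 1 + t₀ + t₁ < s₀ + s₁ + u := by
  obtain ⟨hs₀, hs₁, ht₀, ht₁, hu, h1, h2, h3⟩ := hadm
  have hmax := max_lt_iff.1 h1
  have hmax' := max_lt_iff.1 hmax.2
  have h1s₀ : 1 < s₀ := lt_of_lt_of_le hmax.1 (min_le_left _ _)
  have ht₀s₀ : t₀ < s₀ := lt_of_lt_of_le hmax'.1 (min_le_left _ _)
  have h2t₁ : 2 * t₁ < 2 * s₁ := lt_of_lt_of_le hmax'.2 (min_le_right _ _)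
  have hs₀u : s₀ < u := lt_of_le_of_lt (le_max_left _ _) h2
  linarith

/-- **The translation-free Roy criterion is false** (already in rank one): for every admissible
`(s₀, s₁, t₀, t₁, u)` the statement "`y ∈ ℂ` non-zero, `α ∈ ℂˣ`, and `RoyHypothesis ![y] ![α] s₀ 0
t₀ t₁ u` imply `trdeg_ℚ ℚ(y, α) ≥ 1`" fails at `(y, α) = (1, 1)`. [this work] -/
theorem not_royCriterion_translationFree {s₀ s₁ t₀ t₁ u : ℝ}
    (hadm : RoyAdmissible s₀ s₁ t₀ t₁ u) :
    ¬ ∀ (y α : Fin 1 → ℂ), LinearIndependent ℚ y → (∀ j, α j ≠ 0) →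
        RoyHypothesis y α s₀ 0 t₀ t₁ u →
          (1 : Cardinal) ≤ Algebra.trdeg ℚ
            ↥(IntermediateField.adjoin ℚ (Set.range y ∪ Set.range α)) := by
  intro h
  have hli : LinearIndependent ℚ (![1] : Fin 1 → ℂ) := linearIndependent_unique_iff.2 (by simp)
  have h1 := h ![1] ![1] hli (fun j => by fin_cases j; simp) (royHypothesis_point hadm 1 1)
  have hbot : IntermediateField.adjoin ℚ
      (Set.range (![1] : Fin 1 → ℂ) ∪ Set.range (![1] : Fin 1 → ℂ)) = ⊥ := by
    rw [IntermediateField.adjoin_eq_bot_iff]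
    rintro x hx
    simp at hx
    rw [hx]; exact one_mem _
  rw [hbot, trdeg_eq_zero] at h1
  exact absurd h1 (by norm_num)

/-- **What any proof of a Roy-type criterion must consume.** If, for exponents as in
`royHypothesis_of_subDirichlet` (`s₀, s₁, t₁ ≥ 0`, `u ≥ 1`, `max(s₀, t₀, s₁+t₁) ≤ u`), an
implication "`RoyHypothesis y α s₀ s₁ t₀ t₁ u` ⟹ `Q(y, α)`" holds for all `y, α ∈ ℂ^l` with a
conclusion `Q` that fails somewhere, then the exponents have non-negative Dirichlet excess:
`1 + t₀ + t₁ ≤ s₀ + l s₁ + u`.  (Roy's Conjecture 2 is the case `Q =` "`y` linearly dependent, or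
some `α_j = 0`, or `trdeg_ℚ ℚ(y, α) ≥ l`", exponents in the window; there the excess is positive by
`dirichletExcess_pos_of_royAdmissible`.) [this work] -/
theorem dirichletExcess_nonneg_of_criterion {l : ℕ} {s₀ s₁ t₀ t₁ u : ℝ} (hs₀ : 0 ≤ s₀)
    (hs₁ : 0 ≤ s₁) (ht₁ : 0 ≤ t₁) (hu : 1 ≤ u) (hs₀u : s₀ ≤ u) (ht₀u : t₀ ≤ u)
    (hst : s₁ + t₁ ≤ u) (Q : (Fin l → ℂ) → (Fin l → ℂ) → Prop) (hQ : ∃ y α, ¬ Q y α)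
    (hcrit : ∀ y α : Fin l → ℂ, RoyHypothesis y α s₀ s₁ t₀ t₁ u → Q y α) :
    1 + t₀ + t₁ ≤ s₀ + l * s₁ + u := by
  by_contra hlt
  obtain ⟨y, α, hyα⟩ := hQ
  exact hyα (hcrit y α
    (royHypothesis_of_subDirichlet y α hs₀ hs₁ ht₁ hu hs₀u ht₀u hst (lt_of_not_ge hlt)))

/-- **In rank one the translations alone are void too.** For admissible exponents and ANY
`y, α ∈ ℂ`, Roy's hypothesis with derivation exponent `0` (values, no derivatives, at the
`N^{s₁}` points `(m y, α^m)`) holds: `s₁ + u < 2u − t₁ < 1 + t₀ ≤ 1 + t₀ + t₁`.  Together with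
`royHypothesis_point`: in the rank-one case (where Roy's Theorem 1 refutes the JOINT hypothesis at
`α ∉ e^y·μ_∞`) neither marginal of the data carries information. [this work] -/
theorem royHypothesis_derivativeFree_rankOne {s₀ s₁ t₀ t₁ u : ℝ}
    (hadm : RoyAdmissible s₀ s₁ t₀ t₁ u) (y α : ℂ) : RoyHypothesis ![y] ![α] 0 s₁ t₀ t₁ u := by
  obtain ⟨hs₀, hs₁, ht₀, ht₁, hu, h1, h2, h3⟩ := hadm
  have hmax := max_lt_iff.1 h1
  have hmax' := max_lt_iff.1 hmax.2
  have h1s₀ : 1 < s₀ := lt_of_lt_of_le hmax.1 (min_le_left _ _)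
  have ht₀s₀ : t₀ < s₀ := lt_of_lt_of_le hmax'.1 (min_le_left _ _)
  have hs₀u : s₀ < u := lt_of_le_of_lt (le_max_left _ _) h2
  have hst : s₁ + t₁ < u := lt_of_le_of_lt (le_max_right _ _) h2
  refine royHypothesis_of_subDirichlet ![y] ![α] le_rfl hs₁.le ht₁.le (by linarith) (by linarith)
    (by linarith) hst.le ?_
  push_cast
  linarith

end Summit.Schanuel.Schanuel.Theorems

end
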